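import Mathlib
import Literature.MathematicalPhysics.KineticTheory.HardSphereEulerProofs
import Literature.Analysis.FunctionSpaces.TorusSpaceTime
import Literature.Analysis.FunctionSpaces.TorusCalculusProofs
import HarnessLib

/-!
# `StaticScoreResponse` (support item stmt-AtomisticToContinuum-12269): calculus along smooth
# profile paths

Elementary consequences of joint smoothness `IsSmoothSpaceTimeOn (Icc 0 1)` (torus calculus of
`Literature.Analysis.FunctionSpaces.Torus`) in the shape consumed by the assembly of
`StaticScoreResponse`:

* `uniform_modulus_of_smooth` — uniform-in-space modulus of continuity in time on `[0,1]`;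
* `isSmoothSpaceTimeOn_log`, `timeDerivWithin_log` — `log a` is jointly smooth for a positive
  activity path and `∂_κ log a = ∂_κ a / a` (the position part of the score);
* `hasDerivAt_slice_of_mem_Ioo` — two-sided time derivatives in the interior;
* products `χ · ψ_κ` with a continuous test function: continuity, bounds, moduli, derivatives
  (`continuous_mul_slice`, `exists_bound_mul_slice`, `modulus_mul_slice`, `hasDerivAt_mul_slice`);
* `hasDerivWithinAt_integral_mul_slice` — `d/dκ ∫ χ Ψ_κ = ∫ χ ∂_κΨ_κ` within `[0,1]`;
* `iInf_pos_of_continuous` — a positive continuous function on `𝕋³` has positive infimum.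

Folklore; no definitions, no named facts.
-/

noncomputable section

namespace Summit.AtomisticToContinuum.HydrodynamicLimit.Theorems

open MeasureTheory Metric Set Filter Topology Finset
  Literature.Analysis.FunctionSpaces Literature.Analysis.FunctionSpaces.Torus
  Literature.MathematicalPhysics.KineticTheory

variable {F : Type*} [NormedAddCommGroup F] [NormedSpace ℝ F]

/-! ### Uniform modulus of continuity in time -/

/-- **Uniform-in-space modulus of continuity in time** of a jointly smooth field on `[0,1] × 𝕋³`
(uniform continuity of the lift on the compact `[0,1] × [0,1]³`). [folklore] -/
theorem uniform_modulus_of_smooth {u : ℝ → T3 → F} (hu : IsSmoothSpaceTimeOn (Icc 0 1) u) :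
    ∀ η > (0 : ℝ), ∃ ρ > (0 : ℝ), ∀ κ ∈ Icc (0 : ℝ) 1, ∀ κ' ∈ Icc (0 : ℝ) 1, |κ' - κ| < ρ →
      ∀ x, ‖u κ' x - u κ x‖ ≤ η := by
  intro η hη
  set K : Set (EuclideanSpace ℝ (Fin 3)) := (WithLp.toLp 2) '' (Set.pi univ fun _ : Fin 3 => Icc (0 : ℝ) 1) with hK
  have hKc : IsCompact K := isCompact_toLp_image_pi_Icc
  have hcomp : IsCompact (Icc (0 : ℝ) 1 ×ˢ K) := isCompact_Icc.prod hKc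
  have hcont : ContinuousOn (stLift u) (Icc (0 : ℝ) 1 ×ˢ K) :=
    hu.continuousOn_stLift.mono (prod_mono subset_rfl (subset_univ _))
  have hUC := hcomp.uniformContinuousOn_of_continuous hcont
  rw [Metric.uniformContinuousOn_iff] at hUC
  obtain ⟨ρ, hρ, h⟩ := hUC η hη
  refine ⟨ρ, hρ, fun κ hκ κ' hκ' hd x => ?_⟩
  have hy : repr x ∈ K := repr_mem_toLp_image_pi_Icc x
  have h1 := h (κ', repr x) (mk_mem_prod hκ' hy) (κ, repr x) (mk_mem_prod hκ hy) (by
    rw [Prod.dist_eq, dist_self, max_eq_left dist_nonneg, Real.dist_eq]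
    exact hd)
  rw [stLift_apply, stLift_apply, proj_repr, dist_eq_norm] at h1
  exact h1.le

/-- Real-valued version of the uniform modulus (absolute values). [folklore] -/
theorem uniform_modulus_real_of_smooth {u : ℝ → T3 → ℝ} (hu : IsSmoothSpaceTimeOn (Icc 0 1) u) :
    ∀ η > (0 : ℝ), ∃ ρ > (0 : ℝ), ∀ κ ∈ Icc (0 : ℝ) 1, ∀ κ' ∈ Icc (0 : ℝ) 1, |κ' - κ| < ρ →
      ∀ x, |u κ' x - u κ x| ≤ η := by
  intro η hη
  obtain ⟨ρ, hρ, h⟩ := uniform_modulus_of_smooth hu η hη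
  exact ⟨ρ, hρ, fun κ hκ κ' hκ' hd x => by rw [← Real.norm_eq_abs]; exact h κ hκ κ' hκ' hd x⟩

/-- Real-valued uniform bound on `[0,1] × 𝕋³` (absolute values, positive constant). [folklore] -/
theorem exists_abs_le_of_smooth {u : ℝ → T3 → ℝ} (hu : IsSmoothSpaceTimeOn (Icc 0 1) u) :
    ∃ C : ℝ, 0 < C ∧ ∀ κ ∈ Icc (0 : ℝ) 1, ∀ x, |u κ x| ≤ C := by
  obtain ⟨C, hC⟩ := hu.exists_norm_le_of_isCompact isCompact_Icc subset_rfl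
  refine ⟨max C 1, lt_max_of_lt_right one_pos, fun κ hκ x => ?_⟩
  rw [← Real.norm_eq_abs]
  exact (hC κ hκ x).trans (le_max_left _ _)

/-- Slices of a jointly smooth field on `[0,1]` are continuous. [folklore] -/
theorem continuous_slice_of_smooth {u : ℝ → T3 → F} (hu : IsSmoothSpaceTimeOn (Icc 0 1) u)
    {κ : ℝ} (hκ : κ ∈ Icc (0 : ℝ) 1) : Continuous (u κ) :=
  (hu.isSmooth_slice hκ).continuous

/-- Two-sided time derivatives in the interior of `[0,1]`. [folklore] -/
theorem hasDerivAt_slice_of_mem_Ioo {u : ℝ → T3 → F} (hu : IsSmoothSpaceTimeOn (Icc 0 1) u)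
    {κ : ℝ} (hκ : κ ∈ Ioo (0 : ℝ) 1) (x : T3) :
    HasDerivAt (fun κ => u κ x) (timeDerivWithin (Icc 0 1) u κ x) κ :=
  (hu.hasDerivWithinAt_slice (Ioo_subset_Icc_self hκ) x).hasDerivAt (Icc_mem_nhds hκ.1 hκ.2)

/-! ### The logarithm of a positive activity path -/

/-- `log a` is jointly smooth for a jointly smooth positive activity path. [folklore] -/
theorem isSmoothSpaceTimeOn_log {a : ℝ → T3 → ℝ} (ha : IsSmoothSpaceTimeOn (Icc 0 1) a)
    (ha0 : ∀ κ ∈ Icc (0 : ℝ) 1, ∀ x, 0 < a κ x) : IsSmoothSpaceTimeOn (Icc 0 1) (fun κ x => Real.log (a κ x)) := by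
  unfold IsSmoothSpaceTimeOn at ha ⊢
  have h : stLift (fun κ x => Real.log (a κ x)) = fun z => Real.log (stLift a z) := by
    funext z; rfl
  rw [h]
  exact ha.log fun z hz => (ha0 z.1 (mem_prod.1 hz).1 _).ne'

/-- **The position part of the score**: `∂_κ log a = ∂_κ a / a` within `[0,1]`. [folklore] -/
theorem timeDerivWithin_log {a : ℝ → T3 → ℝ} (ha : IsSmoothSpaceTimeOn (Icc 0 1) a)
    (ha0 : ∀ κ ∈ Icc (0 : ℝ) 1, ∀ x, 0 < a κ x) {κ : ℝ} (hκ : κ ∈ Icc (0 : ℝ) 1) (x : T3) :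
    timeDerivWithin (Icc 0 1) (fun κ x => Real.log (a κ x)) κ x = timeDerivWithin (Icc 0 1) a κ x / a κ x :=
  ((ha.hasDerivWithinAt_slice hκ x).log (ha0 κ hκ x).ne').derivWithin (uniqueDiffOn_Icc_zero_one κ hκ)

/-- Modulus of `log a` from smoothness. [folklore] -/
theorem modulus_log {a : ℝ → T3 → ℝ} (ha : IsSmoothSpaceTimeOn (Icc 0 1) a)
    (ha0 : ∀ κ ∈ Icc (0 : ℝ) 1, ∀ x, 0 < a κ x) :
    ∀ η > (0 : ℝ), ∃ ρ > (0 : ℝ), ∀ κ ∈ Icc (0 : ℝ) 1, ∀ κ' ∈ Icc (0 : ℝ) 1, |κ' - κ| < ρ →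
      ∀ x, |Real.log (a κ' x) - Real.log (a κ x)| ≤ η :=
  uniform_modulus_real_of_smooth (isSmoothSpaceTimeOn_log ha ha0)

/-! ### Products with a continuous test function -/

section MulSlice

variable {χ : T3 → ℝ} {ψ : ℝ → T3 → ℝ}

/-- Continuity of `x ↦ χ x ψ_κ x`. [folklore] -/
theorem continuous_mul_slice (hχ : Continuous χ) (hψ : IsSmoothSpaceTimeOn (Icc 0 1) ψ) {κ : ℝ}
    (hκ : κ ∈ Icc (0 : ℝ) 1) : Continuous fun x => χ x * ψ κ x :=
  hχ.mul (continuous_slice_of_smooth hψ hκ)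

/-- A common bound for `χ ψ_κ` and `χ ∂_κψ_κ` on `[0,1] × 𝕋³`. [folklore] -/
theorem exists_bound_mul_slice (hχ : Continuous χ) (hψ : IsSmoothSpaceTimeOn (Icc 0 1) ψ) :
    ∃ L : ℝ, 0 < L ∧ ∀ κ ∈ Icc (0 : ℝ) 1, ∀ x, |χ x * ψ κ x| ≤ L ∧
      |χ x * timeDerivWithin (Icc 0 1) ψ κ x| ≤ L := by
  obtain ⟨X, hX0, hX⟩ := exists_forall_abs_le_of_continuous hχ
  obtain ⟨C₁, hC₁0, hC₁⟩ := exists_abs_le_of_smooth hψ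
  obtain ⟨C₂, hC₂0, hC₂⟩ := exists_abs_le_of_smooth (hψ.timeDerivWithin uniqueDiffOn_Icc_zero_one)
  refine ⟨X * (C₁ + C₂) + 1, by positivity, fun κ hκ x => ⟨?_, ?_⟩⟩
  · rw [abs_mul]
    nlinarith [mul_le_mul (hX x) (hC₁ κ hκ x) (abs_nonneg _) hX0, abs_nonneg (χ x), hC₂ κ hκ x,
      abs_nonneg (timeDerivWithin (Icc 0 1) ψ κ x)]
  · rw [abs_mul]
    nlinarith [mul_le_mul (hX x) (hC₂ κ hκ x) (abs_nonneg _) hX0, abs_nonneg (χ x), hC₁ κ hκ x,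
      abs_nonneg (ψ κ x)]

/-- Moduli of continuity in `κ` of `χ ψ_κ` and `χ ∂_κψ_κ`, uniformly in `x`. [folklore] -/
theorem modulus_mul_slice (hχ : Continuous χ) (hψ : IsSmoothSpaceTimeOn (Icc 0 1) ψ) :
    ∀ η > (0 : ℝ), ∃ ρ > (0 : ℝ), ∀ κ ∈ Icc (0 : ℝ) 1, ∀ κ' ∈ Icc (0 : ℝ) 1, |κ' - κ| < ρ → ∀ x,
      |χ x * ψ κ' x - χ x * ψ κ x| ≤ η ∧
        |χ x * timeDerivWithin (Icc 0 1) ψ κ' x - χ x * timeDerivWithin (Icc 0 1) ψ κ x| ≤ η := by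
  intro η hη
  obtain ⟨X, hX0, hX⟩ := exists_forall_abs_le_of_continuous hχ
  have hX1 : 0 < X + 1 := by positivity
  obtain ⟨ρ₁, hρ₁, h₁⟩ := uniform_modulus_real_of_smooth hψ (η / (X + 1)) (div_pos hη hX1)
  obtain ⟨ρ₂, hρ₂, h₂⟩ := uniform_modulus_real_of_smooth (hψ.timeDerivWithin uniqueDiffOn_Icc_zero_one) (η / (X + 1)) (div_pos hη hX1)
  refine ⟨min ρ₁ ρ₂, lt_min hρ₁ hρ₂, fun κ hκ κ' hκ' hd x => ⟨?_, ?_⟩⟩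
  · have h := h₁ κ hκ κ' hκ' (lt_of_lt_of_le hd (min_le_left _ _)) x
    rw [← mul_sub, abs_mul]
    calc |χ x| * |ψ κ' x - ψ κ x| ≤ (X + 1) * (η / (X + 1)) :=
          mul_le_mul ((hX x).trans (by linarith)) h (abs_nonneg _) hX1.le
      _ = η := mul_div_cancel₀ _ hX1.ne'
  · have h := h₂ κ hκ κ' hκ' (lt_of_lt_of_le hd (min_le_right _ _)) x
    rw [← mul_sub, abs_mul]
    calc |χ x| * |timeDerivWithin (Icc 0 1) ψ κ' x - timeDerivWithin (Icc 0 1) ψ κ x| ≤ (X + 1) * (η / (X + 1)) :=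
          mul_le_mul ((hX x).trans (by linarith)) h (abs_nonneg _) hX1.le
      _ = η := mul_div_cancel₀ _ hX1.ne'

/-- Interior `κ`-derivative of `χ ψ_κ`. [folklore] -/
theorem hasDerivAt_mul_slice (hψ : IsSmoothSpaceTimeOn (Icc 0 1) ψ) (χ : T3 → ℝ) {κ : ℝ} (hκ : κ ∈ Ioo (0 : ℝ) 1)
    (x : T3) : HasDerivAt (fun κ => χ x * ψ κ x) (χ x * timeDerivWithin (Icc 0 1) ψ κ x) κ :=
  (hasDerivAt_slice_of_mem_Ioo hψ hκ x).const_mul (χ x)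

/-- **Differentiation under `∫_{𝕋³}` of `χ Ψ_κ`** within `[0,1]`: `d/dκ ∫ χ Ψ_κ = ∫ χ ∂_κΨ_κ`. [folklore] -/
theorem hasDerivWithinAt_integral_mul_slice (hχ : Continuous χ) {Ψ : ℝ → T3 → ℝ}
    (hΨ : IsSmoothSpaceTimeOn (Icc 0 1) Ψ) {κ : ℝ} (hκ : κ ∈ Icc (0 : ℝ) 1) :
    HasDerivWithinAt (fun κ => ∫ x, χ x * Ψ κ x) (∫ x, χ x * timeDerivWithin (Icc 0 1) Ψ κ x) (Icc 0 1) κ := by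
  obtain ⟨L, hL0, hL⟩ := exists_bound_mul_slice hχ hΨ
  refine hasDerivWithinAt_integral_of_convex (X := T3) (μ := (volume : Measure T3)) (E := ℝ)
    (F := fun κ x => χ x * Ψ κ x) (F' := fun κ x => χ x * timeDerivWithin (Icc 0 1) Ψ κ x)
    (convex_Icc 0 1) hκ (fun s hs => ?_) (fun s hs x => ?_) (C := L) ?_ ?_
  · exact integrable_of_continuous_T3 (continuous_mul_slice hχ hΨ hs)
  · exact (hΨ.hasDerivWithinAt_slice hs x).const_mul (χ x)
  · refine eventually_nhdsWithin_of_forall fun s hs x => ?_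
    rw [Real.norm_eq_abs]
    exact (hL s hs x).2
  · exact (hχ.mul (continuous_slice_of_smooth (hΨ.timeDerivWithin uniqueDiffOn_Icc_zero_one) hκ)).aestronglyMeasurable

end MulSlice

/-! ### Positive infima -/

/-- A positive continuous function on `𝕋³` has positive infimum. [folklore] -/
theorem iInf_pos_of_continuous {a₁ : T3 → ℝ} (ha : Continuous a₁) (ha0 : ∀ x, 0 < a₁ x) : 0 < ⨅ y, a₁ y := by
  obtain ⟨x₀, -, hmin⟩ := isCompact_univ.exists_isMinOn univ_nonempty ha.continuousOn
  exact lt_of_lt_of_le (ha0 x₀) (le_ciInf fun y => hmin (mem_univ y))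

/-- The supremum of a continuous function on `𝕋³` bounds it. [folklore] -/
theorem le_iSup_of_continuous {a₁ : T3 → ℝ} (ha : Continuous a₁) (x : T3) : a₁ x ≤ ⨆ y, a₁ y := by
  obtain ⟨C, -, hC⟩ := exists_forall_abs_le_of_continuous ha
  exact le_ciSup ⟨C, by rintro _ ⟨y, rfl⟩; exact (le_abs_self _).trans (hC y)⟩ x

end Summit.AtomisticToContinuum.HydrodynamicLimit.Theorems

end
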